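import Mathlib
import HarnessLib
import Summits.HubbardSuperconductivity.HubbardSuperconductivity.Theorems.ComplexGFFStiffnessF4l2AssemblyOfBlockB4
import Summits.HubbardSuperconductivity.HubbardSuperconductivity.Theorems.ComplexGFFStiffnessTwoKernelSkBoundFarField
import Literature.MathematicalPhysics.StatisticalMechanics.AbkmPackageLocalSlots

/-!
# Crux child `TwoKernelSkBound` (stmt-HubbardSuperconductivity-27414), line `banach_two_kernel`:
# `stub_f4l2ShrinkLoc` REDUCED to the kernel parallelogram B4 — the `opS` / `P.shrink` plumbing

Route `route-HubbardSuperconductivity-ComplexGFFStiffness`; memo `Cruxes/HypACumulant/TWOKERNEL-PLAN-27414-v3.md`.  The registered stub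
`stub_f4l2ShrinkLoc : F4l2ShrinkLoc 4` asks, for every package `P`, an `N`-free second-difference slot (F4l2-loc) for the SHRUNK package
`P.shrink`.  `ComplexGFFStiffnessF4l2AssemblyOfBlockB4` (p833574) gives the mixed second `q`-difference of the RAW step map `nextKStep`
in the weak norm for every package with `0 < P.r`, modulo the kernel parallelogram B4 at the fixed intermediate Hamiltonian.  This
file does the remaining plumbing: `Q.opS q k u v = restrictConn (nextKStep D_q (toHam u) (mulExt v))` on the Theorem-6.8 ball
(`packageAt_coe_opS`), the weak norm is blind to `restrictConn`, `P.shrink.r = P.r/8`, and the degenerate ball `P.r = 0` (all four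
corners have norm `≤ σ(0)·0 = 0`).  Result: **`f4l2ShrinkLoc_of_blockB4 : (B4 for every package with 0 < r, in every dimension d) →
F4l2ShrinkLoc d`** — so the registered stub now hinges on B4 alone (the `ℓ = 2` kernel-only twins, memo §2 R4).  All proved, no
`sorry`.  Honest scope: rung route (stiffness of a complex Gaussian gradient field via the [ABKM19] RG); nothing about superconductivity
in the Hubbard model.

## References
* S. Adams, S. Buchholz, R. Kotecký, S. Müller, arXiv:1910.13564, Definition 6.5 (6.34), Theorem 6.8, Lemma 8.4, Lemma 12.6 (12.53)
  [AdamsBuchholzKoteckyMuller2019].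
-/

noncomputable section

-- `Summit.<Summit>.<Problem>`: single-conjunct summit, the duplicate component is mandated (D-0017).
set_option linter.dupNamespace false

namespace Summit.HubbardSuperconductivity.HubbardSuperconductivity.Theorems.ComplexGFF

open scoped BigOperators
open Literature.MathematicalPhysics.StatisticalMechanics.GradientRG
open Literature.MathematicalPhysics.StatisticalMechanics.TorusPolymer (IsPolymer reblock)
open Literature.Barriers.CriticalPhenomena.LongRangePhi4.Polymer (IsConn)
open Literature.MathematicalPhysics.StatisticalMechanics

variable {d : ℕ}

/-- `restrictConn` is additive. [cite: AdamsBuchholzKoteckyMuller2019, Ch. 6.2] -/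
theorem restrictConn_add' {M : ℕ} [NeZero M] (s : ℕ) (K K' : Finset (Fin d → ZMod M) → ((Fin d → ZMod M) → ℝ) → ℂ) :
    restrictConn s (K + K') = restrictConn s K + restrictConn s K' := by
  have h := restrictConn_sub (s := s) (K := K + K') (K' := K')
  rw [add_sub_cancel_right] at h
  rw [h, sub_add_cancel]

set_option maxHeartbeats 1600000 in
/-- **`stub_f4l2ShrinkLoc` modulo B4** (module docstring): the kernel parallelogram at the fixed intermediate Hamiltonian for every
package with positive radius implies the local `N`-free second-difference slot for every shrunk package.
[cite: AdamsBuchholzKoteckyMuller2019, Lemma 12.6 (12.53) / Lemma 8.4 / Theorem 6.8] -/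
theorem f4l2ShrinkLoc_of_blockB4
    (hB4 : ∀ (P : PackageData d) [Fact (0 < P.h)] [Fact (0 < P.L)], 0 < P.r →
      ∃ l₄ T₂ : ℝ, 0 ≤ l₄ ∧ 0 < T₂ ∧ ∀ (N M : ℕ) [NeZero M] (Q : PackageAt P N M),
      ∀ q y z : Matrix (Fin d) (Fin d) ℝ, P.InBall q → P.InBall (q + y) → P.InBall (q + z) → P.InBall (q + y + z) →
      esum y ≤ T₂ → esum z ≤ T₂ → ∀ k, k + 1 ≤ N →
      ∀ (u : HamSpace ℂ d (fieldWt P.h (P.L : ℝ) d k) ((P.L : ℝ) ^ k) (P.L ^ (d * k)))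
        (v : activitySpace Q.normParams k) (cv : ℝ), ‖u‖ ≤ P.r →
        activityNormLE Q.normParams k v cv → cv ≤ P.r →
      WeakNormLE Q.normParams (k + 1)
        (fun X ψ =>
          nextK (abkmStepData P.L P.R k (Q.kernels (q + y + z))).s
              (reblock (abkmStepData P.L P.R k (Q.kernels (q + y + z))).s
                ((abkmStepData P.L P.R k (Q.kernels (q + y + z))).L * (abkmStepData P.L P.R k (Q.kernels (q + y + z))).s))
              (stepMeasure (abkmStepData P.L P.R k (Q.kernels (q + y + z))).𝒞) (expNegH (HamSpace.toHam u))
              (expNegH (nextH (abkmStepData P.L P.R k (Q.kernels q)) (HamSpace.toHam u)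
                (mulExt ((v : activitySpace Q.normParams k) : Finset (Fin d → ZMod M) → ((Fin d → ZMod M) → ℝ) → ℂ))))
              (mulExt ((v : activitySpace Q.normParams k) : Finset (Fin d → ZMod M) → ((Fin d → ZMod M) → ℝ) → ℂ)) X ψ -
          nextK (abkmStepData P.L P.R k (Q.kernels (q + y))).s
              (reblock (abkmStepData P.L P.R k (Q.kernels (q + y))).s
                ((abkmStepData P.L P.R k (Q.kernels (q + y))).L * (abkmStepData P.L P.R k (Q.kernels (q + y))).s))
              (stepMeasure (abkmStepData P.L P.R k (Q.kernels (q + y))).𝒞) (expNegH (HamSpace.toHam u))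
              (expNegH (nextH (abkmStepData P.L P.R k (Q.kernels q)) (HamSpace.toHam u)
                (mulExt ((v : activitySpace Q.normParams k) : Finset (Fin d → ZMod M) → ((Fin d → ZMod M) → ℝ) → ℂ))))
              (mulExt ((v : activitySpace Q.normParams k) : Finset (Fin d → ZMod M) → ((Fin d → ZMod M) → ℝ) → ℂ)) X ψ -
          nextK (abkmStepData P.L P.R k (Q.kernels (q + z))).s
              (reblock (abkmStepData P.L P.R k (Q.kernels (q + z))).s
                ((abkmStepData P.L P.R k (Q.kernels (q + z))).L * (abkmStepData P.L P.R k (Q.kernels (q + z))).s))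
              (stepMeasure (abkmStepData P.L P.R k (Q.kernels (q + z))).𝒞) (expNegH (HamSpace.toHam u))
              (expNegH (nextH (abkmStepData P.L P.R k (Q.kernels q)) (HamSpace.toHam u)
                (mulExt ((v : activitySpace Q.normParams k) : Finset (Fin d → ZMod M) → ((Fin d → ZMod M) → ℝ) → ℂ))))
              (mulExt ((v : activitySpace Q.normParams k) : Finset (Fin d → ZMod M) → ((Fin d → ZMod M) → ℝ) → ℂ)) X ψ +
          nextK (abkmStepData P.L P.R k (Q.kernels q)).s
              (reblock (abkmStepData P.L P.R k (Q.kernels q)).s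
                ((abkmStepData P.L P.R k (Q.kernels q)).L * (abkmStepData P.L P.R k (Q.kernels q)).s))
              (stepMeasure (abkmStepData P.L P.R k (Q.kernels q)).𝒞) (expNegH (HamSpace.toHam u))
              (expNegH (nextH (abkmStepData P.L P.R k (Q.kernels q)) (HamSpace.toHam u)
                (mulExt ((v : activitySpace Q.normParams k) : Finset (Fin d → ZMod M) → ((Fin d → ZMod M) → ℝ) → ℂ))))
              (mulExt ((v : activitySpace Q.normParams k) : Finset (Fin d → ZMod M) → ((Fin d → ZMod M) → ℝ) → ℂ)) X ψ)
        (l₄ * esum y * esum z * max ‖u‖ cv)) :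
    F4l2ShrinkLoc d := by
  intro P _ _
  by_cases hr : P.r = 0
  · /- the degenerate ball: every corner has norm `≤ σ·0 = 0` -/
    refine ⟨0, 1, le_rfl, one_pos, fun N M _ Q => ?_⟩
    intro q y z hq hqy hqz hqyz _hy _hz k hk u v cv hu hv hcv
    have hPA : 0 < Q.normParams.A := P.shrink.A_pos
    have hQn := isSubaddNormBound_activityNormLE Q.normParams hPA
    have hMt : M = Q.normParams.L ^ k * P.shrink.L ^ (N - k) := by
      show M = P.shrink.L ^ k * P.shrink.L ^ (N - k)
      rw [Q.hM, ← pow_add, Nat.add_sub_cancel' (by omega)]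
    have hcv0 : 0 ≤ cv := nonneg_of_weakNormLE hPA hMt P.shrink.hLodd.pow P.shrink.hLodd.pow hv
    have hr' : P.shrink.r = 0 := by rw [PackageData.shrink_r, hr, zero_div]
    have hm0 : max ‖u‖ cv = 0 :=
      le_antisymm (by rw [← hr']; exact max_le hu hcv) (le_max_of_le_left (norm_nonneg _))
    have h11 := activityNormLE_opS_le P.shrink Q hqyz hk u v hu hv hcv
    have h10 := activityNormLE_opS_le P.shrink Q hqy hk u v hu hv hcv
    have h01 := activityNormLE_opS_le P.shrink Q hqz hk u v hu hv hcv
    have h00 := activityNormLE_opS_le P.shrink Q hq hk u v hu hv hcv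
    have hs1 := hQn.sub (k + 1) _ _ _ _ h11 h10
    have hs2 := hQn.sub (k + 1) _ _ _ _ h01 h00
    have hs := hQn.sub (k + 1) _ _ _ _ hs1 hs2
    have e3 : Q.opS (q + y + z) k u v - Q.opS (q + y) k u v - Q.opS (q + z) k u v + Q.opS q k u v =
        (Q.opS (q + y + z) k u v - Q.opS (q + y) k u v) - (Q.opS (q + z) k u v - Q.opS q k u v) := by abel
    rw [e3]
    refine hQn.mono (k + 1) _ _ _ hs (le_of_eq ?_)
    rw [hm0]; ring
  /- positive radius: the kernel-level assembly for `P.shrink`, then the `opS` plumbing -/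
  have hr0 : 0 < P.r := lt_of_le_of_ne P.hr0 (Ne.symm hr)
  have hr0' : 0 < P.shrink.r := by rw [PackageData.shrink_r]; positivity
  obtain ⟨l, T₂, hl, hT₂, hF⟩ := exists_weakNormLE_secondDiff_nextKStep_of_blockB4 P.shrink hr0' (hB4 P.shrink hr0')
  refine ⟨l, T₂, hl, hT₂, fun N M _ Q => ?_⟩
  intro q y z hq hqy hqz hqyz hy hz k hk u v cv hu hv hcv
  have hW := hF N M Q q y z hq hqy hqz hqyz hy hz k hk u v cv hu hv hcv
  have hW' : WeakNormLE Q.normParams (k + 1)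
      (nextKStep (abkmStepData P.shrink.L P.shrink.R k (Q.kernels (q + y + z))) (HamSpace.toHam u)
          (mulExt ((v : activitySpace Q.normParams k) : Finset (Fin d → ZMod M) → ((Fin d → ZMod M) → ℝ) → ℂ)) -
        nextKStep (abkmStepData P.shrink.L P.shrink.R k (Q.kernels (q + y))) (HamSpace.toHam u)
          (mulExt ((v : activitySpace Q.normParams k) : Finset (Fin d → ZMod M) → ((Fin d → ZMod M) → ℝ) → ℂ)) -
        nextKStep (abkmStepData P.shrink.L P.shrink.R k (Q.kernels (q + z))) (HamSpace.toHam u)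
          (mulExt ((v : activitySpace Q.normParams k) : Finset (Fin d → ZMod M) → ((Fin d → ZMod M) → ℝ) → ℂ)) +
        nextKStep (abkmStepData P.shrink.L P.shrink.R k (Q.kernels q)) (HamSpace.toHam u)
          (mulExt ((v : activitySpace Q.normParams k) : Finset (Fin d → ZMod M) → ((Fin d → ZMod M) → ℝ) → ℂ)))
      (l * esum y * esum z * max ‖u‖ cv) := hW
  show WeakNormLE Q.normParams (k + 1)
    (((Q.opS (q + y + z) k u v - Q.opS (q + y) k u v - Q.opS (q + z) k u v + Q.opS q k u v :
        activitySpace Q.normParams (k + 1)) :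
      Finset (Fin d → ZMod M) → ((Fin d → ZMod M) → ℝ) → ℂ)) (l * esum y * esum z * max ‖u‖ cv)
  rw [Submodule.coe_add, Submodule.coe_sub, Submodule.coe_sub,
    packageAt_coe_opS P.shrink Q hqyz hk u v hu hv hcv, packageAt_coe_opS P.shrink Q hqy hk u v hu hv hcv,
    packageAt_coe_opS P.shrink Q hqz hk u v hu hv hcv, packageAt_coe_opS P.shrink Q hq hk u v hu hv hcv,
    ← restrictConn_sub, ← restrictConn_sub, ← restrictConn_add']
  exact (weakNormLE_restrictConn_iff (P := Q.normParams) (k := k + 1)).2 hW'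

end Summit.HubbardSuperconductivity.HubbardSuperconductivity.Theorems.ComplexGFF

end
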